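import Summits.RiemannHypothesis.RiemannHypothesis.Theorems.HandoffDodgerWitnessDefs
import HarnessLib

/-!
# HANDOFF — the node PAIRING: `Π_ρ (z_ρ²)^{m(ρ)}` is the positive real `Π_ρ ‖z_ρ‖^{2m(ρ)}` (rh-explicit, track «HANDOFF», seat prove-2 gen9, ATTEMPT-18 (D-3)/(R-3))

HONEST FRAMING. Nothing here bears on the truth of RH. The killed multiset `zerosBetween 0 T` of the dodger is closed under `ρ ↦ 1 − ρ̄`
(`HandoffDodgerWitnessDefs.one_sub_conj_mem_zerosBetween`), with equal multiplicities and conjugate nodes (`z_{1−ρ̄} = conj z_ρ`); the zeros ON the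
critical line are the fixed points and have REAL nodes `z_ρ = Im ρ`. Consequently (`prod_dodgerNode_sq_pow_eq`)

  `Π_{ρ ∈ zerosBetween 0 T} (z_ρ²)^{m(ρ)} = Π_ρ ‖z_ρ‖^{2m(ρ)}`  (a positive real),

by `Finset.prod_involution` applied to the ratio `(z_ρ²)^m/(‖z_ρ‖²)^m` (paired factors multiply to `1`, fixed factors are `1`). USE: the edge value of
the dodger cut-off is `F₀(b) = (1/2b)·Πℓ²/Π(z_ρ²)^m` (HOME `HandoffDodgerEdgeValue.lean`), hence the POSITIVE real `c_∞/(2b)` with the cost theorem's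
`c_∞ = Πℓ²/Π‖z_ρ‖^{2m}` — the sign the collar lemmas (`HandoffDodgerCollar`) need. No RH anywhere: off-line zeros are paired, not excluded.
No `sorry`, standard axioms, no definitions.

References: this track (ATTEMPT-18 §1 (D-3), §3 (R-3)).
-/

set_option linter.dupNamespace false

noncomputable section

open Complex Finset
open scoped ComplexConjugate

namespace Summit.RiemannHypothesis.RiemannHypothesis.Theorems.Handoff

open Literature.NumberTheory.LFunctions Literature.NumberTheory.LFunctions.SchoenfeldBound

/-- `z·z̄ = ‖z‖²` in `ℂ`. [folklore] -/
theorem mul_conj_eq_norm_sq_ofReal (z : ℂ) : z * conj z = (((‖z‖ ^ 2 : ℝ)) : ℂ) := by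
  rw [Complex.mul_conj, Complex.normSq_eq_norm_sq, Complex.ofReal_pow]

/-- A node on the critical line is real: `Re ρ = ½ ⟹ z_ρ = Im ρ`. [folklore] -/
theorem dodgerNode_of_re_eq_half {ρ : ℂ} (h : ρ.re = 1 / 2) : dodgerNode ρ = ((ρ.im : ℝ) : ℂ) := by
  apply Complex.ext <;> simp [h]

/-- **The node pairing.** `Π_{ρ ∈ zerosBetween 0 T} (z_ρ²)^{m(ρ)} = Π_ρ ‖z_ρ‖^{2m(ρ)}` (as complex numbers): the killed multiset is closed
under `ρ ↦ 1 − ρ̄` with conjugate nodes and equal multiplicities, and fixed points have real nodes. [this track, ATTEMPT-18 (D-3)] -/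
theorem prod_dodgerNode_sq_pow_eq (T : ℝ) :
    ∏ ρ ∈ zerosBetween 0 T, (dodgerNode ρ ^ 2) ^ (riemannZetaZeroOrder ρ).toNat =
      ((∏ ρ ∈ zerosBetween 0 T, ‖dodgerNode ρ‖ ^ (2 * (riemannZetaZeroOrder ρ).toNat) : ℝ) : ℂ) := by
  have him : ∀ ρ ∈ zerosBetween 0 T, 0 < ρ.im := fun ρ hρ => ((mem_zerosBetween le_rfl).1 hρ).2.2.2.1
  have hz : ∀ ρ ∈ zerosBetween 0 T, dodgerNode ρ ≠ 0 := fun ρ hρ => dodgerNode_ne_zero (him ρ hρ).ne'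
  have hN : ∀ ρ ∈ zerosBetween 0 T, (((‖dodgerNode ρ‖ ^ 2 : ℝ)) : ℂ) ≠ 0 := fun ρ hρ => by
    exact_mod_cast pow_ne_zero 2 (norm_ne_zero_iff.2 (hz ρ hρ))
  -- the pairing ratio has product one
  have key : ∏ ρ ∈ zerosBetween 0 T, (dodgerNode ρ ^ 2) ^ (riemannZetaZeroOrder ρ).toNat /
      (((‖dodgerNode ρ‖ ^ 2 : ℝ)) : ℂ) ^ (riemannZetaZeroOrder ρ).toNat = 1 := by
    refine Finset.prod_involution (fun ρ _ => 1 - conj ρ) ?_ ?_ (fun ρ hρ => one_sub_conj_mem_zerosBetween hρ)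
      (fun ρ _ => by simp)
    · -- paired factors multiply to one
      intro ρ hρ
      rw [zeroOrder_one_sub_conj hρ, dodgerNode_one_sub_conj, Complex.norm_conj, div_mul_div_comm, ← mul_pow, ← mul_pow,
        ← mul_pow, mul_conj_eq_norm_sq_ofReal, ← sq]
      exact div_self (pow_ne_zero _ (pow_ne_zero _ (hN ρ hρ)))
    · -- fixed points (zeros on the line) have ratio one
      intro ρ hρ hne heq
      apply hne
      have hre : ρ.re = 1 / 2 := by
        have h := congrArg Complex.re heq
        simp only [Complex.sub_re, Complex.one_re, Complex.conj_re] at h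
        linarith
      rw [dodgerNode_of_re_eq_half hre, Complex.norm_real, Real.norm_eq_abs, sq_abs]
      push_cast
      exact div_self (pow_ne_zero _ (pow_ne_zero _ (by exact_mod_cast (him ρ hρ).ne')))
  have hden : ∏ ρ ∈ zerosBetween 0 T, (((‖dodgerNode ρ‖ ^ 2 : ℝ)) : ℂ) ^ (riemannZetaZeroOrder ρ).toNat ≠ 0 :=
    Finset.prod_ne_zero_iff.2 fun ρ hρ => pow_ne_zero _ (hN ρ hρ)
  rw [Finset.prod_div_distrib, div_eq_one_iff_eq hden] at key
  rw [key]
  push_cast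
  exact Finset.prod_congr rfl fun ρ _ => by rw [← pow_mul]

/-- The same product is a POSITIVE real. [this track, ATTEMPT-18 (D-3)] -/
theorem prod_norm_dodgerNode_pow_pos (T : ℝ) :
    0 < ∏ ρ ∈ zerosBetween 0 T, ‖dodgerNode ρ‖ ^ (2 * (riemannZetaZeroOrder ρ).toNat) :=
  Finset.prod_pos fun _ hρ => pow_pos (norm_pos_iff.2
    (dodgerNode_ne_zero ((mem_zerosBetween le_rfl).1 hρ).2.2.2.1.ne')) _

end Summit.RiemannHypothesis.RiemannHypothesis.Theorems.Handoff

end
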